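import Summits.NavierStokesRegularity.NavierStokesRegularity.Theorems.StretchingWellBindingEnstrophyQuarterLawFarFieldEnstrophy
import Literature.Analysis.FluidPDE.NSUnconditionalUniquenessHolds
import HarnessLib

/-!
# Shelf crux `EnstrophyQuarterLaw` (stmt-NavierStokesRegularity-1574): the EARLY-SLAB enstrophy
# bound as a Theorems helper, and the two-piece a-priori portrait of the enstrophy

Theorems file (seat ns-lqd-p2 g7; `--supports` the shelf crux; answers the critic's request
P2⁶ on line «sparse_sieve» — "land `earlySlab_enstrophy_bound` under Theorems as an S helper": the
lemma was proved inside the Cruxes skeleton `Cruxes/EnstrophyQuarterLaw/Lines/birth.lean`, which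
Theorems files and other routes cannot import). Navier–Stokes regularity is NOT proved by anything
here; the quarter law stays OPEN.

* `earlySlab_enstrophy_bound` — a classical solution on `[0, T)`, Leray–Hopf from a rapidly decaying
  datum, has `∫ |curl u(t)|² ≤ B₀` on every closed sub-slab `[0, t₁]`, `0 < t₁ < T` (Tao 2011
  Cor. 11.1 in the crux's classes: `tao2011_boundedEnstrophy_holds`, `u ∈ X¹([0,t₁] × ℝ³)`, and
  `|curl v| ≤ ‖curl‖ |Dv|`; proof adapted verbatim from the birth skeleton, planner nsreg lineage);
* `enstrophy_apriori_portrait` — the two KNOWN pieces of every quarter-law decomposition together: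
  for a maximal classical solution on `[0,T)` (LH, rapidly decaying datum) there are `ρ`, `B₀`, `B`
  with `∫ |curl u(t)|² ≤ B₀` on `[0, T/2]` and `∫_{ℝ³∖B(0,ρ)} |curl u(t)|² ≤ B` on `[T/2, T)` — so the
  quarter law (and the blow-up of the enstrophy) is entirely a statement about the CORE `B(0, ρ)` on
  the FINAL half `[T/2, T)`.

References: T. Tao, Anal. PDE 6 (2013) = arXiv:1108.1165v4, Thm. 10.1, Remark 10.6, Cor. 11.1.
-/

noncomputable section

-- the summit and its single sub-problem share the name (CONVENTIONS §1), as in every Theorems file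
set_option linter.dupNamespace false

namespace Summit.NavierStokesRegularity.NavierStokesRegularity.Theorems.EnstrophyQuarterLaw.SparseSieve

open MeasureTheory Set Filter Topology Metric Function
open Literature.Analysis Literature.Analysis.FluidPDE
open scoped ENNReal NNReal

/-- **Early-slab enstrophy bound** (Tao 2011 Cor. 11.1 in the crux's classes). A classical solution
on `[0, T)` which is Leray–Hopf from a rapidly decaying datum has bounded enstrophy
`∫ |curl u(t)|² ≤ B₀` on every closed sub-slab `[0, t₁]`, `0 < t₁ < T`: the Leray–Hopf energy
inequality (`IsLerayHopfOn.eEnergy_le_datum`) and the Schwartz datum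
(`HasRapidSpatialDecay.lintegral_enorm_iteratedFDeriv_sq_lt_top`) feed the tree theorem
`tao2011_boundedEnstrophy_holds` (`u ∈ X¹([0, t₁] × ℝ³)`), and `|curl v| ≤ ‖curlCLM‖ |Dv|`.
[cite: Tao2011, Cor. 11.1 (arXiv:1108.1165v4 p. 68)] -/
theorem earlySlab_enstrophy_bound {ν T : ℝ} (hν : 0 < ν)
    {u : ℝ → EuclideanSpace ℝ (Fin 3) → EuclideanSpace ℝ (Fin 3)}
    {p : ℝ → EuclideanSpace ℝ (Fin 3) → ℝ}
    (hcl : IsClassicalNSSolutionOn (Ico 0 T) ν 0 u p) (hLH : IsLerayHopfOn T ν 0 (u 0) u)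
    (hdec : HasRapidSpatialDecay (u 0)) {t₁ : ℝ} (ht₁ : 0 < t₁) (ht₁T : t₁ < T) :
    ∃ B₀ : ℝ, 0 ≤ B₀ ∧ ∀ t ∈ Icc 0 t₁, ∫⁻ x, ‖curl (u t) x‖ₑ ^ 2 ≤ ENNReal.ofReal B₀ := by
  -- adapted from Cruxes/EnstrophyQuarterLaw/Lines/birth.lean (`earlySlab_enstrophy_bound`)
  have hcl₁ : IsClassicalNSSolutionOn (Icc 0 t₁) ν 0 u p :=
    hcl.mono (Icc_subset_Ico_right ht₁T) (uniqueDiffOn_Icc ht₁)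
  have hE : ∃ C : ℝ≥0, ∀ t ∈ Icc 0 t₁, ∫⁻ x, ‖u t x‖ₑ ^ 2 ≤ C := by
    refine ⟨(2 * VectorCalculus.kineticEnergy (u 0)).toNNReal, fun t ht => ?_⟩
    exact hLH.eEnergy_le_datum hν.le ⟨ht.1, ht.2.trans ht₁T.le⟩
  have hX : MemSobolevX 1 t₁ u :=
    tao2011_boundedEnstrophy_holds hν ht₁ hcl₁ hE (hdec.lintegral_enorm_iteratedFDeriv_sq_lt_top 1)
  obtain ⟨C₁, hC₁⟩ := hX.1 1 le_rfl
  have hfin : ENNReal.ofReal (‖(curlCLM)‖ ^ 2) * (C₁ : ℝ≥0∞) ≠ ⊤ :=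
    ENNReal.mul_ne_top ENNReal.ofReal_ne_top ENNReal.coe_ne_top
  refine ⟨(ENNReal.ofReal (‖(curlCLM)‖ ^ 2) * (C₁ : ℝ≥0∞)).toReal, ENNReal.toReal_nonneg,
    fun t ht => ?_⟩
  rw [ENNReal.ofReal_toReal hfin]
  exact (lintegral_curl_sq_le (u t)).trans (mul_le_mul_right (hC₁ t ht) _)

/-- **The a-priori portrait of the enstrophy at a first blow-up time** — the two KNOWN pieces
of every quarter-law decomposition: for a maximal classical solution on `[0, T)`, Leray–Hopf from a
rapidly decaying datum, there are `ρ` and `B₀, B ≥ 0` with `∫ |curl u(t)|² ≤ B₀` for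
`t ∈ [0, T/2]` (early slab, Tao Cor. 11.1) and `∫_{ℝ³∖B(0,ρ)} |curl u(t)|² ≤ B` for `t ∈ [T/2, T)`
(far field, Tao Thm. 10.1 / Rem. 10.6 — `stub_farFieldEnstrophy`): the enstrophy can blow up only
inside the core `B(0, ρ)` on the final half. [cite: Tao2011, Thm. 10.1 + Remark 10.6, Cor. 11.1] -/
theorem enstrophy_apriori_portrait {ν T : ℝ} (hν : 0 < ν) (hT : 0 < T)
    {u : ℝ → EuclideanSpace ℝ (Fin 3) → EuclideanSpace ℝ (Fin 3)}
    {p : ℝ → EuclideanSpace ℝ (Fin 3) → ℝ}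
    (hmax : IsMaximalSmoothSolution ν 0 u p T) (hLH : IsLerayHopfOn T ν 0 (u 0) u)
    (hdec : HasRapidSpatialDecay (u 0)) :
    ∃ ρ B₀ B : ℝ, 0 ≤ B₀ ∧ 0 ≤ B ∧
      (∀ t ∈ Icc 0 (T / 2), ∫⁻ x, ‖curl (u t) x‖ₑ ^ 2 ≤ ENNReal.ofReal B₀) ∧
      (∀ t ∈ Ico (T / 2) T,
        ∫⁻ x in (ball (0 : EuclideanSpace ℝ (Fin 3)) ρ)ᶜ, ‖curl (u t) x‖ₑ ^ 2 ≤ ENNReal.ofReal B) := by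
  obtain ⟨B₀, hB₀, hearly⟩ := earlySlab_enstrophy_bound hν hmax.1 hLH hdec (t₁ := T / 2)
    (by positivity) (by linarith)
  obtain ⟨ρ, B, hB, hfar⟩ := stub_farFieldEnstrophy ν T hν hT u p hmax hLH hdec
  exact ⟨ρ, B₀, B, hB₀, hB, hearly, hfar⟩

end Summit.NavierStokesRegularity.NavierStokesRegularity.Theorems.EnstrophyQuarterLaw.SparseSieve

end
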